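import Summits.AtomisticToContinuum.Crystallization.Theorems.HolmgrenBoyleLindGroundStatesChargeFLCEquilibriumOfBulkDefectVanish
import Summits.AtomisticToContinuum.Crystallization.Theses.MinMeanCycleStackingLock

/-!
# Crux `HolmgrenBoyleLind.GroundStatesChargeFLCEquilibrium` (stmt-AtomisticToContinuum-6076)
# and the shared hinge `GroundStatesChargePeriodic` (stmt-AtomisticToContinuum-2911)
# from the BASED hinge `BulkDefectVanishBased` (route `MinMeanCycleStackingLock`)

`BulkDefectVanishBased` is the base-point form of `BulkDefectVanish` (matching with
`x_i + A(P.points − p)`, `p ∈ P.points`, instead of `x_i + A(P.points)`; no vertex at the origin is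
forced, so dhcp-type polytypes are admissible limits). Its counted predicate is VERBATIM the
predicate of the hinge `GroundStatesChargePeriodic` (2911), with the fraction of bad particles
tending to `0` instead of a positive density of good ones frequently in `N`; so

* `groundStatesChargePeriodic_of_bulkDefectVanishBased : BulkDefectVanishBased →
  GroundStatesChargePeriodic` (`Q := P`, `ρ := 1/2`, eventually hence frequently — the counting
  lemma `half_mul_le_natCard_of_natCard_not_div_lt` of the un-based file);
* `groundStatesChargeFLCEquilibrium_of_bulkDefectVanishBased : BulkDefectVanishBased →
  GroundStatesChargeFLCEquilibrium` (composed with the landed 2911 ⇒ crux, p145894);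
* `bulkDefectVanishBased_of_bulkDefectVanish : BulkDefectVanish → BulkDefectVanishBased` (the
  remark "0751 implies it (p = 0)" of the route text of `MinMeanCycleStackingLock`, via
  `zero_mem_points_of_bulkDefectVanish`; it needs a ground-state sequence to exist at all, which is
  the proved Literature fact `LennardJonesGroundStatesExist_holds`).

CONDITIONAL results (both hinges are open); all `[folklore]` glue; nothing here closes an item.
-/

noncomputable section

open MeasureTheory Filter
open scoped ENNReal Topology

namespace Summit.AtomisticToContinuum.Crystallization.Theorems.HolmgrenBoyleLindGroundStatesChargeFLCEquilibrium

open Literature.MathematicalPhysics.StatisticalMechanics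

/-- **`BulkDefectVanishBased` ⇒ `GroundStatesChargePeriodic` (2911)** — CONDITIONAL on the open
based hinge of route `MinMeanCycleStackingLock`. The counted predicates agree verbatim; the bad
fraction tends to `0`, so eventually it is `< 1/2` and at least `N/2` particles are good
(`ρ := 1/2`); eventually implies frequently. [folklore] -/
theorem groundStatesChargePeriodic_of_bulkDefectVanishBased :
    Summit.AtomisticToContinuum.Crystallization.Theses.MinMeanCycleStackingLock.BulkDefectVanishBased →
    Summit.AtomisticToContinuum.Crystallization.Theses.HolmgrenBoyleLind.GroundStatesChargePeriodic := by
  classical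
  rintro ⟨P, hP⟩ x hx
  refine ⟨P, fun R ε hR hε => ⟨1 / 2, one_half_pos, ?_⟩⟩
  have hev := (hP R ε hR hε x hx).eventually
    (gt_mem_nhds (show (0 : ℝ) < 1 / 2 from one_half_pos))
  refine Filter.Eventually.frequently ?_
  filter_upwards [hev] with N hN
  exact half_mul_le_natCard_of_natCard_not_div_lt _ hN

/-- **`BulkDefectVanishBased` ⇒ the crux `GroundStatesChargeFLCEquilibrium` (6076)** —
CONDITIONAL, composed from `groundStatesChargePeriodic_of_bulkDefectVanishBased` and the landed
`groundStatesChargeFLCEquilibrium_of_groundStatesChargePeriodic` (2911 ⇒ crux). [folklore] -/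
theorem groundStatesChargeFLCEquilibrium_of_bulkDefectVanishBased :
    Summit.AtomisticToContinuum.Crystallization.Theses.MinMeanCycleStackingLock.BulkDefectVanishBased →
    Summit.AtomisticToContinuum.Crystallization.Theses.HolmgrenBoyleLind.GroundStatesChargeFLCEquilibrium :=
  fun h => groundStatesChargeFLCEquilibrium_of_groundStatesChargePeriodic
    (groundStatesChargePeriodic_of_bulkDefectVanishBased h)

/-- **`BulkDefectVanish` (0751) ⇒ `BulkDefectVanishBased`** ("0751 implies it, `p = 0`"): the
periodic configuration `P` of 0751 has `0 ∈ P.points` (`zero_mem_points_of_bulkDefectVanish`,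
applied along one ground-state sequence, which exists by `LennardJonesGroundStatesExist_holds`), and
with base point `p := 0` the two counted predicates coincide (`q - 0 = q`, `dist q 0 = ‖q‖`), so the
bad sets agree and so do the fractions. [folklore] -/
theorem bulkDefectVanishBased_of_bulkDefectVanish :
    Summit.AtomisticToContinuum.Crystallization.Theses.CrystalKissingRigidity.BulkDefectVanish →
    Summit.AtomisticToContinuum.Crystallization.Theses.MinMeanCycleStackingLock.BulkDefectVanishBased := by
  classical
  rintro ⟨P, hP⟩
  -- a ground-state sequence exists, so `0 ∈ P.points`
  choose x₀ hx₀ using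
    (show ∀ N : ℕ, ∃ y : Fin N → EuclideanSpace ℝ (Fin 3), IsGroundState lennardJones y from
      LennardJonesGroundStatesExist_holds)
  have h0 : (0 : EuclideanSpace ℝ (Fin 3)) ∈ P.points :=
    zero_mem_points_of_bulkDefectVanish P x₀ fun R ε hR hε => hP R ε hR hε x₀ hx₀
  refine ⟨P, fun R ε hR hε x hx => ?_⟩
  -- the based bad set is contained in the origin-based bad set (base point `p := 0`)
  refine squeeze_zero (fun N => by positivity) (fun N => ?_) (hP R ε hR hε x hx)
  rcases Nat.eq_zero_or_pos N with hN | hN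
  · subst hN; simp
  have hNpos : (0 : ℝ) < N := by exact_mod_cast hN
  rw [div_le_div_iff_of_pos_right hNpos]
  set bad : Fin N → Prop := fun i => ¬ ∃ A : EuclideanSpace ℝ (Fin 3) →ₗᵢ[ℝ] EuclideanSpace ℝ (Fin 3),
      (∀ p ∈ P.points, ‖p‖ ≤ R → ∃ j : Fin N, dist (x N j) (x N i + A p) ≤ ε) ∧
      (∀ j : Fin N, dist (x N j) (x N i) ≤ R → ∃ p ∈ P.points, dist (x N j) (x N i + A p) ≤ ε)
    with hbad
  set badB : Fin N → Prop := fun i => ¬ ∃ A : EuclideanSpace ℝ (Fin 3) →ₗᵢ[ℝ] EuclideanSpace ℝ (Fin 3),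
      ∃ p ∈ P.points,
        (∀ q ∈ P.points, dist q p ≤ R → ∃ j : Fin N, dist (x N j) (x N i + A (q - p)) ≤ ε) ∧
        (∀ j : Fin N, dist (x N j) (x N i) ≤ R →
          ∃ q ∈ P.points, dist (x N j) (x N i + A (q - p)) ≤ ε)
    with hbadB
  have himp : ∀ i : Fin N, badB i → bad (id i) := by
    rintro i hi ⟨A, hA₁, hA₂⟩
    refine hi ⟨A, 0, h0, fun q hq hqR => ?_, fun j hj => ?_⟩
    · rw [dist_zero_right] at hqR
      simpa only [sub_zero, id] using hA₁ q hq hqR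
    · simpa only [sub_zero, id] using hA₂ j hj
  exact_mod_cast Nat.card_le_card_of_injective (Subtype.map id himp)
    (Subtype.map_injective himp Function.injective_id)

end Summit.AtomisticToContinuum.Crystallization.Theorems.HolmgrenBoyleLindGroundStatesChargeFLCEquilibrium

end
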